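import Summits.QuantumAdvantage.QuantumAdvantage.Theorems.SosSandwichPseudoBoundedAABooleanCorner
import Summits.QuantumAdvantage.QuantumAdvantage.Theorems.SosSandwichPseudoBoundedAASymmetricCornerPrep
import Literature.Computability.Complexity.CertificateAlgorithm
import HarnessLib

/-!
# Crux `PseudoBoundedAA` (stmt-QuantumAdvantage-15237) / `AAConj` (10748) — the APPROXIMATELY-BOOLEAN corner:
# a bounded polynomial that pointwise `1/3`-approximates a total Boolean function satisfies AA, `maxInf ≥ Var²/(1024 d¹²)`

The tree's Boolean corner (`BooleanCorner.exists_influence_ge_of_boolean`, OSSS + Midrijanis) needs a polynomial that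
is EXACTLY `{0,1}`-valued, and its robust form (`exists_influence_ge_of_near_booleanCorner`) needs an exactly Boolean
member of `K_T` nearby.  This file removes exactness altogether: if a `[0,1]`-bounded `p` of degree `≤ d` POINTWISE
`ε`-approximates a total Boolean `f` (`|p(x) − f(x)| ≤ ε ≤ 1/3` for all `x`) and `4ε² ≤ Var[p]`, then
`∃ j, Var[p]²/(1024 d¹²) ≤ Inf_j[p]`.  Route: Nisan–Szegedy with a `1/3`-approximating polynomial gives `bs(f) ≤ 4d²`
(tree `card_le_four_mul_sq_of_approx`), Beals et al. `D(f) ≤ bs(f)³ ≤ 64 d⁶` (tree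
`detQueryComplexity_le_blockSensitivity_pow_three`), and the pure-OSSS robust corner `4Var² ≤ D(f)²·maxInf` (tree
`exists_influence_ge_of_near_boolean`).  This is the corner of ACCEPTANCE PROBABILITIES OF BOUNDED-ERROR ALGORITHMS FOR
TOTAL FUNCTIONS (error `ε ≤ 1/3`, `Var ≥ 4ε²`), quantum or classical, with no exact representation required.

* `blockSensitivity_le_of_approx` (`bs(f) ≤ 4d²`), `detQueryComplexity_le_of_approx` (`D(f) ≤ 64d⁶`),
* `exists_influence_ge_of_approx_boolean` (the display), `aaConj_approxBooleanCorner` (`(c, C) = (12, 1/1024)` in the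
  shape of `AAConj`), `pseudoBoundedAA_approxBooleanCorner` (`(c, C) = (12, 1/4194304)` in the shape of
  `PseudoBoundedAA`, `d = 2T`).

Honest label: a known corner (polynomial method + OSSS) in kernel; no stub, crux or summit is closed.
Sources: Nisan–Szegedy 1994 Lemma 3.8; Beals–Buhrman–Cleve–Mosca–de Wolf 2001 Thm 4.13, §5; O'Donnell–Saks–Schramm–
Servedio 2005 Thm 3.2; Aaronson–Ambainis arXiv:0911.0996 Conj. 6.
-/

-- D-0017: single-conjunct summit ⇒ the duplicate `QuantumAdvantage.QuantumAdvantage` is mandated.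
set_option linter.dupNamespace false

noncomputable section

open Finset Function
open Literature.Computability.Complexity Literature.Computability.QuantumComplexity
open Summit.QuantumAdvantage.QuantumAdvantage.Theorems.SosSandwich.BooleanCorner
  (exists_influence_ge_of_near_boolean exists_totalDegree_le_of_pseudoBounded)

namespace Summit.QuantumAdvantage.QuantumAdvantage.Theorems.SosSandwich.ApproxBooleanCorner

variable {N : ℕ}

/-- **`bs(f) ≤ 4d²` from a `1/3`-approximating bounded polynomial of degree `≤ d`** (Nisan–Szegedy via the tree's
`card_le_four_mul_sq_of_approx`). [cite: NisanSzegedy1994, Lemma 3.8] [cite: BealsEtAl2001, Thm 4.13 (proof)] -/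
theorem blockSensitivity_le_of_approx {d : ℕ} (p : MvPolynomial (Fin N) ℝ) (hdeg : p.totalDegree ≤ d)
    (hb : ∀ x, 0 ≤ evalBool p x ∧ evalBool p x ≤ 1) (f : (Fin N → Bool) → Bool) {ε : ℝ} (hε : ε ≤ 1 / 3)
    (happ : ∀ x, |evalBool p x - realOf f x| ≤ ε) : blockSensitivity f ≤ 4 * d ^ 2 := by
  classical
  -- adapted from `BooleanCorner.blockSensitivity_le_of_pseudoBounded` (exact representation ↦ ε-approximation)
  have hP01 : ∀ z : Fin N → Bool, 0 ≤ MvPolynomial.eval (Multilinear.boolPt (R := ℝ) z) p ∧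
      MvPolynomial.eval (Multilinear.boolPt (R := ℝ) z) p ≤ 1 := fun z => hb z
  have hlo : ∀ z, f z = false → evalBool p z ≤ 1 / 3 := by
    intro z hz
    have h := happ z
    rw [realOf_apply, hz] at h
    simp only [Bool.false_eq_true, if_false, sub_zero] at h
    linarith [le_abs_self (evalBool p z)]
  have hhi : ∀ z, f z = true → 2 / 3 ≤ evalBool p z := by
    intro z hz
    have h := happ z
    rw [realOf_apply, hz, if_pos rfl] at h
    linarith [neg_abs_le (evalBool p z - 1)]
  obtain ⟨x, B, hsens, hdisj⟩ := exists_blocks_of_blockSensitivity f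
  rcases Nat.eq_zero_or_pos (blockSensitivity f) with hb0 | hb1
  · rw [hb0]; exact Nat.zero_le _
  cases hfx : f x with
  | false =>
    refine card_le_four_mul_sq_of_approx x hdisj p hdeg hP01 ?_ ?_ hb1
    · exact hlo x hfx
    · intro j
      have hfj : f (flipBlock x (B j)) = true := by
        have := hsens j; rw [hfx] at this; simpa using this
      exact hhi _ hfj
  | true =>
    refine card_le_four_mul_sq_of_approx x hdisj (1 - p) ?_ ?_ ?_ ?_ hb1
    · exact (MvPolynomial.totalDegree_sub _ _).trans (max_le (by simp) hdeg)
    · intro z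
      simp only [map_sub, map_one]
      constructor <;> linarith [(hP01 z).1, (hP01 z).2]
    · simp only [map_sub, map_one]
      change 1 - evalBool p x ≤ 1 / 3
      linarith [hhi x hfx]
    · intro j
      have hfj : f (flipBlock x (B j)) = false := by
        have := hsens j; rw [hfx] at this; simpa using this
      simp only [map_sub, map_one]
      change 2 / 3 ≤ 1 - evalBool p (flipBlock x (B j))
      linarith [hlo _ hfj]

/-- **`D(f) ≤ 64 d⁶`** for a total Boolean `f` that is `1/3`-approximated pointwise by a bounded polynomial of degree
`≤ d` (`D ≤ bs³`, Beals et al. §5). [cite: BealsEtAl2001, §5 (Lemmas 5.2, 5.3)] [cite: NisanSzegedy1994, Lemma 3.8] -/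
theorem detQueryComplexity_le_of_approx {d : ℕ} (p : MvPolynomial (Fin N) ℝ) (hdeg : p.totalDegree ≤ d)
    (hb : ∀ x, 0 ≤ evalBool p x ∧ evalBool p x ≤ 1) (f : (Fin N → Bool) → Bool) {ε : ℝ} (hε : ε ≤ 1 / 3)
    (happ : ∀ x, |evalBool p x - realOf f x| ≤ ε) : detQueryComplexity f ≤ 64 * d ^ 6 := by
  calc detQueryComplexity f ≤ blockSensitivity f ^ 3 := detQueryComplexity_le_blockSensitivity_pow_three f
    _ ≤ (4 * d ^ 2) ^ 3 := Nat.pow_le_pow_left (blockSensitivity_le_of_approx p hdeg hb f hε happ) 3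
    _ = 64 * d ^ 6 := by ring

/-- **Approximately-Boolean corner of Aaronson–Ambainis.**  A `[0,1]`-bounded `p` of degree `≤ d` with
`|p(x) − f(x)| ≤ ε ≤ 1/3` for a total Boolean `f` and all `x`, and `4ε² ≤ Var[p]`, has a variable with
`Var[p]²/(1024 d¹²) ≤ Inf_j[p]`. [cite: OdonnellEtAl2005, Thm 3.2] [cite: BealsEtAl2001, Thm 4.13] -/
theorem exists_influence_ge_of_approx_boolean {d : ℕ} (p : MvPolynomial (Fin N) ℝ) (hdeg : p.totalDegree ≤ d)
    (hb : ∀ x, 0 ≤ evalBool p x ∧ evalBool p x ≤ 1) (f : (Fin N → Bool) → Bool) {ε : ℝ} (hε : ε ≤ 1 / 3)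
    (happ : ∀ x, |evalBool p x - realOf f x| ≤ ε) (hvar : 4 * ε ^ 2 ≤ boolVariance p) (hv : 0 < boolVariance p) :
    ∃ j : Fin N, boolVariance p ^ 2 / (1024 * (d : ℝ) ^ 12) ≤ influence j p := by
  -- `L²`-closeness from pointwise closeness
  have happrox : 4 * boolAvg (fun x => (evalBool p x - realOf f x) ^ 2) ≤ boolVariance p := by
    have hpt : ∀ x, (evalBool p x - realOf f x) ^ 2 ≤ ε ^ 2 := by
      intro x
      have h := happ x
      have h0 : 0 ≤ ε := (abs_nonneg _).trans h
      calc (evalBool p x - realOf f x) ^ 2 = |evalBool p x - realOf f x| ^ 2 := (sq_abs _).symm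
        _ ≤ ε ^ 2 := pow_le_pow_left₀ (abs_nonneg _) h 2
    have hle : boolAvg (fun x => (evalBool p x - realOf f x) ^ 2) ≤ ε ^ 2 := by
      calc boolAvg (fun x => (evalBool p x - realOf f x) ^ 2) ≤ boolAvg (fun _ : Fin N → Bool => ε ^ 2) := by
            unfold boolAvg
            exact div_le_div_of_nonneg_right (Finset.sum_le_sum fun x _ => hpt x) (by positivity)
        _ = ε ^ 2 := boolAvg_const _
    linarith
  obtain ⟨j, hj⟩ := exists_influence_ge_of_near_boolean p f happrox hv
  refine ⟨j, ?_⟩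
  have hD : (detQueryComplexity f : ℝ) ≤ 64 * (d : ℝ) ^ 6 := by
    exact_mod_cast detQueryComplexity_le_of_approx p hdeg hb f hε happ
  have hD0 : (0 : ℝ) ≤ (detQueryComplexity f : ℝ) := by positivity
  have hI := influence_nonneg j p
  have h4 : 4 * boolVariance p ^ 2 ≤ (64 * (d : ℝ) ^ 6) ^ 2 * influence j p :=
    hj.trans (by gcongr)
  rcases Nat.eq_zero_or_pos d with hd0 | hdpos
  · -- `d = 0`: `p` is constant on the cube, so `Var = 0` — contradiction with `hv`
    exfalso
    subst hd0
    have hD0' : detQueryComplexity f = 0 := by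
      have := detQueryComplexity_le_of_approx p hdeg hb f hε happ
      simpa using this
    rw [hD0'] at hj
    simp at hj
    nlinarith
  · have hd : (0 : ℝ) < (d : ℝ) := by exact_mod_cast hdpos
    rw [div_le_iff₀ (by positivity)]
    nlinarith [h4]

/-- **The statement of the route decl `AAConj` on the approximately-Boolean corner** (`(c, C) = (12, 1/1024)`): for
`p` as above with `0 < ε₀ ≤ Var[p]`, some variable has `(1/1024)(ε₀/d)¹² ≤ Inf_j[p]`. [cite: AaronsonAmbainis2014, Conj. 6] -/
theorem aaConj_approxBooleanCorner (N d : ℕ) (p : MvPolynomial (Fin N) ℝ) (ε₀ : ℝ)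
    (f : (Fin N → Bool) → Bool) {ε : ℝ} (hε : ε ≤ 1 / 3) (happ : ∀ x, |evalBool p x - realOf f x| ≤ ε)
    (hvar : 4 * ε ^ 2 ≤ boolVariance p)
    (hd : 1 ≤ d) (hdeg : p.totalDegree ≤ d) (hb : ∀ x, 0 ≤ evalBool p x ∧ evalBool p x ≤ 1)
    (hε₀ : 0 < ε₀) (hε₀V : ε₀ ≤ boolVariance p) :
    ∃ j : Fin N, 1 / 1024 * (ε₀ / d) ^ 12 ≤ influence j p := by
  obtain ⟨j, hj⟩ := exists_influence_ge_of_approx_boolean p hdeg hb f hε happ hvar (lt_of_lt_of_le hε₀ hε₀V)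
  refine ⟨j, le_trans ?_ hj⟩
  have hd0 : (0 : ℝ) < (d : ℝ) := by exact_mod_cast hd
  have hV1 : boolVariance p ≤ 1 := by
    have h := SymmetricCorner.boolVariance_le_quarter hb
    linarith
  have hε1 : ε₀ ≤ 1 := hε₀V.trans hV1
  rw [div_pow]
  have h12 : ε₀ ^ 12 ≤ ε₀ ^ 2 := pow_le_pow_of_le_one hε₀.le hε1 (by norm_num)
  have hsq : ε₀ ^ 2 ≤ boolVariance p ^ 2 := pow_le_pow_left₀ hε₀.le hε₀V 2
  have hd12 : (0 : ℝ) < (d : ℝ) ^ 12 := by positivity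
  rw [show 1 / 1024 * (ε₀ ^ 12 / (d : ℝ) ^ 12) = ε₀ ^ 12 / (1024 * (d : ℝ) ^ 12) by field_simp]
  exact div_le_div_of_nonneg_right (h12.trans hsq) (by positivity)

/-- **The statement of `SosSandwich.PseudoBoundedAA` (15237) on the approximately-Boolean corner**
(`(c, C) = (12, 1/4194304)`): a pseudo-bounded `p` of order `T ≥ 1` (degree `≤ 2T` on the cube) that pointwise
`ε`-approximates a total Boolean `f` (`ε ≤ 1/3`, `4ε² ≤ Var[p]`), with `0 < ε₀ ≤ Var[p]`, has a variable with
`(1/4194304)(ε₀/T)¹² ≤ Inf_j[p]`. [cite: AaronsonAmbainis2014, Conj. 6] [cite: KaniewskiLeeDewolf2015, Def. 7] -/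
theorem pseudoBoundedAA_approxBooleanCorner (N T : ℕ) (p : MvPolynomial (Fin N) ℝ) (ε₀ : ℝ)
    (f : (Fin N → Bool) → Bool) {ε : ℝ} (hε : ε ≤ 1 / 3) (happ : ∀ x, |evalBool p x - realOf f x| ≤ ε)
    (hvar : 4 * ε ^ 2 ≤ boolVariance p)
    (hT : 1 ≤ T) (hpb : PseudoBounded T p) (hε₀ : 0 < ε₀) (hε₀V : ε₀ ≤ boolVariance p) :
    ∃ j : Fin N, 1 / 4194304 * (ε₀ / T) ^ 12 ≤ influence j p := by
  obtain ⟨P, hPdeg, hP⟩ := exists_totalDegree_le_of_pseudoBounded hpb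
  have hfun : evalBool P = evalBool p := funext hP
  have hVP : boolVariance P = boolVariance p := by unfold boolVariance; rw [hfun]
  have hIP : ∀ i, influence i P = influence i p := by intro i; unfold influence; rw [hfun]
  have hbP : ∀ x, 0 ≤ evalBool P x ∧ evalBool P x ≤ 1 := by
    intro x; rw [hP x]; exact ⟨hpb.eval_nonneg x, hpb.eval_le_one x⟩
  have happP : ∀ x, |evalBool P x - realOf f x| ≤ ε := by intro x; rw [hP x]; exact happ x
  have hvarP : 4 * ε ^ 2 ≤ boolVariance P := by rw [hVP]; exact hvar
  have hε₀VP : ε₀ ≤ boolVariance P := by rw [hVP]; exact hε₀V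
  have h2T : 1 ≤ 2 * T := by omega
  obtain ⟨j, hj⟩ := aaConj_approxBooleanCorner N (2 * T) P ε₀ f hε happP hvarP h2T hPdeg hbP hε₀ hε₀VP
  refine ⟨j, ?_⟩
  rw [hIP] at hj
  refine le_trans (le_of_eq ?_) hj
  push_cast
  ring

end Summit.QuantumAdvantage.QuantumAdvantage.Theorems.SosSandwich.ApproxBooleanCorner

end
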